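import Mathlib.Analysis.SpecialFunctions.Exp
import Mathlib.Algebra.BigOperators.Ring.Finset
import Summits.QuantumFields.BalabanUV.T4Continuum.Support.NE7PerturbedComposites
import HarnessLib

/-!
# NE7PerturbedCompositesAdd — COMPOSITES OF PERTURBED ADDITIVE LIFTS (the `→+` twin of ✓ `NE7PerturbedComposites`, for lifts that are only known to be ADDITIVE on the data — row NE3's `R₀` comes with ✓ `rightInvW0_sub` but no homogeneity lemma): if the runs of `r` obey `p_i(r_i∘⋯∘r_{i+t−1} u) ≤ C̄·ρ^t·p_{i+t}(u)` and `p_j(δ_j u) ≤ η_j·p_{j+1}(u)`, then the composites of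
# `r + δ` obey **`p_i((r+δ)_i∘⋯∘(r+δ)_{i+t−1} u) ≤ C̄·Π_{j<t}(1 + C̄η_{i+j}∕ρ)·ρ^t·p_{i+t}(u) ≤ C̄·exp((C̄∕ρ)Σ_{j<t}η_{i+j})·ρ^t·p_{i+t}(u)`** — the ratio `ρ` is UNCHANGED and the constant
# depends only on the SUM of the perturbation sizes (Duhamel + backward Gronwall, exact telescoping); a predicate `Good` (periodicity) is threaded through
# (lineage `b2b-balaban-t4-ne7b-p1`, gen 163; route (H′), memo `t4/b2b-balaban-t4-ne7b-p1/g163/records/SCOPING-R4.md` §2∕§5, file (R4a′))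

Cell `pub-balaban`, rung (B)+1 sub-cell t4, lineage `b2b-balaban-t4-ne7b-p1` (row NE7b OWNER + CRUX PROVER; junction service for row NE7 on ROAD-G116 §6 (G3) ∕ the ℓ² route to (G′)),
generation 163.
WHY.  (C) ✓ `NE7ExactLiftComposites.sqrt_dirSq_liftIter_le` bounds the composites of the FLAT exact lift with ratio `ρ`, `ρ² = 7.197 < 8`.  At the curved tower backgrounds the exact lift of
record will be `r_W = r + δ_W` with `‖δ_W‖ = O(w + L·b)` (bondwise radius `b`, memo SCOPING-R4 §3), and along the tower the sizes `η_i` are geometric in the depth (`N_i a_i`, `1∕N_i`), so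
their SUM is bounded uniformly in the number of levels (§2).  THIS FILE is the abstract bookkeeping that turns «bounded sum of perturbations» into «same ratio, larger constant» — with no
smallness assumption on the individual `η_j`.
WHAT ([folklore]; one DATA def `compA`; 0 sorry; `V` any additive commutative group, maps `V →+ V`, `p : ℕ → V → ℝ` subadditive functionals vanishing at `0`, nonnegative):
§1 `compA f i t = f_i ∘ f_{i+1} ∘ ⋯ ∘ f_{i+t−1}` (`compA f i 0 = id`), `compA_succ_apply`, **`duhamel`**:
   `compA (r+δ) i t u = compA r i t u + Σ_{s<t} compA r i s (δ_{i+s} (compA (r+δ) (i+s+1) (t−1−s) u))`;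
§2 (reused from the linear twin) `telescope_prod`, `prod_one_add_le_exp`;
§3 `good_compA`, **`perturbed_compA_le`** (product form) and **`perturbed_compA_le_exp`** (exponential form) — proofs verbatim from the linear twin.
WHAT IS NOT HERE: the dictionary to the tree's lifts (`p_i = √dirSq(·)[0,N_i)⁴`, `Good i` = `N_i`-periodic, `r` = ✓ `exactLift`, `δ` = the curved correction) — files (R4b–d).
HONEST FRAMING (page 1): elementary real∕linear bookkeeping about OUR objects; nothing of Bałaban's asserted; NOT (G3), NOT (G′), NOT NE7∕NE3 as spine nodes; row NE7b NOT PRINTED ∕ NOT PROVED;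
spine 0∕9; finite T⁴ rung (B)+1 — NOT infinite volume, NOT mass gap, NOT BetaPertH, NOT Clay.
-/

set_option autoImplicit false

open scoped BigOperators
open Finset

namespace Summit.QuantumFields.BalabanUV.T4Continuum.NE7PerturbedCompositesAdd

noncomputable section

variable {V : Type*} [AddCommGroup V]

/-! ## §1 Composites and the Duhamel expansion -/

/-- **THE COMPOSITE OF `t` CONSECUTIVE MAPS STARTING AT INDEX `i`**: `compA f i 0 = id`, `compA f i (t+1) = f i ∘ compA f (i+1) t`. [folklore] -/
def compA (f : ℕ → V →+ V) : ℕ → ℕ → (V →+ V)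
  | _, 0 => AddMonoidHom.id V
  | i, t + 1 => (f i).comp (compA f (i + 1) t)

/-- `compA f i 0 u = u`. [folklore] -/
@[simp] theorem compA_zero_apply (f : ℕ → V →+ V) (i : ℕ) (u : V) : compA f i 0 u = u := rfl

/-- `compA f i (t+1) u = f i (compA f (i+1) t u)`. [folklore] -/
theorem compA_succ_apply (f : ℕ → V →+ V) (i t : ℕ) (u : V) : compA f i (t + 1) u = f i (compA f (i + 1) t u) := rfl

/-- **DUHAMEL (first-perturbation expansion)**:
`compA (r+δ) i t u = compA r i t u + Σ_{s<t} compA r i s (δ (i+s) (compA (r+δ) (i+s+1) (t−1−s) u))`. [folklore] -/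
theorem duhamel (r δ : ℕ → V →+ V) : ∀ (t i : ℕ) (u : V),
    compA (r + δ) i t u = compA r i t u + ∑ s ∈ range t, compA r i s (δ (i + s) (compA (r + δ) (i + s + 1) (t - 1 - s) u)) := by
  intro t
  induction t with
  | zero => intro i u; simp
  | succ t ih =>
      intro i u
      rw [compA_succ_apply, compA_succ_apply, Pi.add_apply, AddMonoidHom.add_apply, ih (i + 1) u, map_add, map_sum,
        Finset.sum_range_succ' (fun s => compA r i s (δ (i + s) (compA (r + δ) (i + s + 1) (t + 1 - 1 - s) u)))]
      simp only [compA_zero_apply, add_zero, Nat.add_sub_cancel]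
      have hterm : ∀ s ∈ range t, (r i) ((compA r (i + 1) s) ((δ (i + 1 + s)) ((compA (r + δ) (i + 1 + s + 1) (t - 1 - s)) u)))
          = (compA r i (s + 1)) ((δ (i + (s + 1))) ((compA (r + δ) (i + (s + 1) + 1) (t - (s + 1))) u)) := by
        intro s hs
        have hs' := Finset.mem_range.mp hs
        rw [compA_succ_apply, show i + 1 + s = i + (s + 1) by ring, show t - 1 - s = t - (s + 1) by omega]
      rw [Finset.sum_congr rfl hterm, ← ih (i + 1) u]
      abel

/-! ## §2 The telescoping product and the exponential bound are ✓ `NE7PerturbedComposites.telescope_prod` ∕ `prod_one_add_le_exp` -/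

open NE7PerturbedComposites (telescope_prod prod_one_add_le_exp)

/-! ## §3 The bound on perturbed composites -/

section Bound

variable (p : ℕ → V → ℝ) (Good : ℕ → V → Prop) (r δ : ℕ → V →+ V)

/-- The composites of `r + δ` preserve the predicate (if each `r_j`, `δ_j` maps `Good (j+1)` to `Good j` and `Good j` is closed under addition). [folklore] -/
theorem good_compA (hGadd : ∀ j (a b : V), Good j a → Good j b → Good j (a + b))
    (hGr : ∀ j (u : V), Good (j + 1) u → Good j (r j u)) (hGδ : ∀ j (u : V), Good (j + 1) u → Good j (δ j u)) :
    ∀ (t i : ℕ) (u : V), Good (i + t) u → Good i (compA (r + δ) i t u) := by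
  intro t
  induction t with
  | zero => intro i u hu; simpa using hu
  | succ t ih =>
      intro i u hu
      rw [compA_succ_apply, Pi.add_apply, AddMonoidHom.add_apply]
      have h1 : Good (i + 1) (compA (r + δ) (i + 1) t u) := ih (i + 1) u (by rw [show i + 1 + t = i + (t + 1) by ring]; exact hu)
      exact hGadd i _ _ (hGr i _ h1) (hGδ i _ h1)

/-- The composites of `r` preserve the predicate. [folklore] -/
theorem good_compA_base (hGr : ∀ j (u : V), Good (j + 1) u → Good j (r j u)) :
    ∀ (t i : ℕ) (u : V), Good (i + t) u → Good i (compA r i t u) := by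
  intro t
  induction t with
  | zero => intro i u hu; simpa using hu
  | succ t ih =>
      intro i u hu
      rw [compA_succ_apply]
      exact hGr i _ (ih (i + 1) u (by rw [show i + 1 + t = i + (t + 1) by ring]; exact hu))

/-- **COMPOSITES OF PERTURBED LIFTS, PRODUCT FORM.**  `p_i` subadditive, vanishing at `0`; run letters `p_i(compA r i t u) ≤ C̄ρ^t p_{i+t}(u)` and perturbation letters
`p_j(δ_j u) ≤ η_j p_{j+1}(u)` on good inputs (`C̄, η ≥ 0`, `ρ > 0`).  Then on good inputs
`p_i(compA (r+δ) i t u) ≤ C̄·Π_{j<t}(1 + C̄η_{i+j}∕ρ)·ρ^t·p_{i+t}(u)`. [folklore] -/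
theorem perturbed_compA_le (hp0 : ∀ i, p i 0 = 0) (hpadd : ∀ i (a b : V), p i (a + b) ≤ p i a + p i b)
    (hGadd : ∀ j (a b : V), Good j a → Good j b → Good j (a + b))
    (hGr : ∀ j (u : V), Good (j + 1) u → Good j (r j u)) (hGδ : ∀ j (u : V), Good (j + 1) u → Good j (δ j u))
    {Cb ρ : ℝ} (hCb : 0 ≤ Cb) (hρ : 0 < ρ) {η : ℕ → ℝ} (hη : ∀ j, 0 ≤ η j)
    (hR : ∀ (i t : ℕ) (u : V), Good (i + t) u → p i (compA r i t u) ≤ Cb * ρ ^ t * p (i + t) u)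
    (hδ : ∀ (j : ℕ) (u : V), Good (j + 1) u → p j (δ j u) ≤ η j * p (j + 1) u) :
    ∀ (t i : ℕ) (u : V), Good (i + t) u →
      p i (compA (r + δ) i t u) ≤ Cb * (∏ j ∈ range t, (1 + Cb * η (i + j) / ρ)) * ρ ^ t * p (i + t) u := by
  intro t
  induction t using Nat.strong_induction_on with
  | _ t ih =>
      intro i u hu
      rw [duhamel r δ t i u]
      -- the unperturbed run
      have h0 := hR i t u hu
      -- each Duhamel term
      have hterm : ∀ s ∈ range t, p i (compA r i s (δ (i + s) (compA (r + δ) (i + s + 1) (t - 1 - s) u)))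
          ≤ Cb * ρ ^ t * p (i + t) u * ((Cb * η (i + s) / ρ) * ∏ j ∈ range (t - 1 - s), (1 + Cb * η (i + s + 1 + j) / ρ)) := by
        intro s hs
        have hst : s < t := Finset.mem_range.mp hs
        set W : V := compA (r + δ) (i + s + 1) (t - 1 - s) u with hW
        have hWgood : Good (i + s + 1) W := good_compA Good r δ hGadd hGr hGδ (t - 1 - s) (i + s + 1) u (by rw [show i + s + 1 + (t - 1 - s) = i + t by omega]; exact hu)
        have hδgood : Good (i + s) (δ (i + s) W) := hGδ (i + s) W hWgood
        have h1 := hR i s (δ (i + s) W) hδgood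
        have h2 := hδ (i + s) W hWgood
        have h3 := ih (t - 1 - s) (by omega) (i + s + 1) u (by rw [show i + s + 1 + (t - 1 - s) = i + t by omega]; exact hu)
        rw [show i + s + 1 + (t - 1 - s) = i + t by omega] at h3
        have hP0 : 0 ≤ ∏ j ∈ range (t - 1 - s), (1 + Cb * η (i + s + 1 + j) / ρ) :=
          Finset.prod_nonneg fun j _ => by have := hη (i + s + 1 + j); positivity
        calc p i (compA r i s (δ (i + s) W)) ≤ Cb * ρ ^ s * p (i + s) (δ (i + s) W) := h1
          _ ≤ Cb * ρ ^ s * (η (i + s) * p (i + s + 1) W) := mul_le_mul_of_nonneg_left h2 (by positivity)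
          _ ≤ Cb * ρ ^ s * (η (i + s) * (Cb * (∏ j ∈ range (t - 1 - s), (1 + Cb * η (i + s + 1 + j) / ρ)) * ρ ^ (t - 1 - s) * p (i + t) u)) :=
              mul_le_mul_of_nonneg_left (mul_le_mul_of_nonneg_left h3 (hη _)) (by positivity)
          _ = Cb * ρ ^ t * p (i + t) u * ((Cb * η (i + s) / ρ) * ∏ j ∈ range (t - 1 - s), (1 + Cb * η (i + s + 1 + j) / ρ)) := by
              have hρt : ρ ^ t = ρ ^ s * ρ ^ (t - 1 - s) * ρ := by
                rw [← pow_add, ← pow_succ]; congr 1; omega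
              rw [hρt]
              field_simp
      have hsum := (NE7PerturbedCompositesAdd_subadd_sum p i (hp0 i) (hpadd i) (range t) _).trans (Finset.sum_le_sum hterm)
      calc p i (compA r i t u + ∑ s ∈ range t, compA r i s (δ (i + s) (compA (r + δ) (i + s + 1) (t - 1 - s) u)))
          ≤ p i (compA r i t u) + p i (∑ s ∈ range t, compA r i s (δ (i + s) (compA (r + δ) (i + s + 1) (t - 1 - s) u))) := hpadd i _ _
        _ ≤ Cb * ρ ^ t * p (i + t) u + ∑ s ∈ range t, Cb * ρ ^ t * p (i + t) u * ((Cb * η (i + s) / ρ) * ∏ j ∈ range (t - 1 - s), (1 + Cb * η (i + s + 1 + j) / ρ)) :=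
            add_le_add h0 hsum
        _ = Cb * ρ ^ t * p (i + t) u * (1 + ∑ s ∈ range t, (Cb * η (i + s) / ρ) * ∏ j ∈ range (t - 1 - s), (1 + Cb * η (i + s + 1 + j) / ρ)) := by
            rw [← Finset.mul_sum]; ring
        _ = Cb * (∏ j ∈ range t, (1 + Cb * η (i + j) / ρ)) * ρ ^ t * p (i + t) u := by
            rw [telescope_prod (fun j => Cb * η j / ρ) t i]; ring
where
  /-- finite subadditivity (local copy of the pattern of ✓ `NE7LevelMassBudget.subadd_sum_le`, kept private to this proof). -/
  NE7PerturbedCompositesAdd_subadd_sum (p : ℕ → V → ℝ) (i : ℕ) (hp0 : p i 0 = 0) (hp : ∀ a b : V, p i (a + b) ≤ p i a + p i b)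
      (s : Finset ℕ) (f : ℕ → V) : p i (∑ k ∈ s, f k) ≤ ∑ k ∈ s, p i (f k) := by
    classical
    induction s using Finset.induction_on with
    | empty => simp [hp0]
    | insert a s ha ih =>
        rw [Finset.sum_insert ha, Finset.sum_insert ha]
        exact (hp _ _).trans (by linarith)

/-- **COMPOSITES OF PERTURBED LIFTS, EXPONENTIAL FORM**: `p_i(compA (r+δ) i t u) ≤ C̄·exp((C̄∕ρ)·Σ_{j<t}η_{i+j})·ρ^t·p_{i+t}(u)` on good inputs. [folklore] -/
theorem perturbed_compA_le_exp (hp0 : ∀ i, p i 0 = 0) (hpadd : ∀ i (a b : V), p i (a + b) ≤ p i a + p i b) (hpnn : ∀ i (u : V), 0 ≤ p i u)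
    (hGadd : ∀ j (a b : V), Good j a → Good j b → Good j (a + b))
    (hGr : ∀ j (u : V), Good (j + 1) u → Good j (r j u)) (hGδ : ∀ j (u : V), Good (j + 1) u → Good j (δ j u))
    {Cb ρ : ℝ} (hCb : 0 ≤ Cb) (hρ : 0 < ρ) {η : ℕ → ℝ} (hη : ∀ j, 0 ≤ η j)
    (hR : ∀ (i t : ℕ) (u : V), Good (i + t) u → p i (compA r i t u) ≤ Cb * ρ ^ t * p (i + t) u)
    (hδ : ∀ (j : ℕ) (u : V), Good (j + 1) u → p j (δ j u) ≤ η j * p (j + 1) u)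
    (t i : ℕ) (u : V) (hu : Good (i + t) u) :
    p i (compA (r + δ) i t u) ≤ Cb * Real.exp ((Cb / ρ) * ∑ j ∈ range t, η (i + j)) * ρ ^ t * p (i + t) u := by
  have h := perturbed_compA_le p Good r δ hp0 hpadd hGadd hGr hGδ hCb hρ hη hR hδ t i u hu
  have hexp : ∏ j ∈ range t, (1 + Cb * η (i + j) / ρ) ≤ Real.exp ((Cb / ρ) * ∑ j ∈ range t, η (i + j)) := by
    have h1 := prod_one_add_le_exp (range t) (x := fun j => Cb * η (i + j) / ρ) (fun j _ => by have := hη (i + j); positivity)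
    refine h1.trans (le_of_eq ?_)
    congr 1
    rw [Finset.mul_sum]
    exact Finset.sum_congr rfl fun j _ => by ring
  calc p i (compA (r + δ) i t u) ≤ Cb * (∏ j ∈ range t, (1 + Cb * η (i + j) / ρ)) * ρ ^ t * p (i + t) u := h
    _ ≤ Cb * Real.exp ((Cb / ρ) * ∑ j ∈ range t, η (i + j)) * ρ ^ t * p (i + t) u := by
        have := hpnn (i + t) u
        have := pow_pos hρ t
        gcongr

end Bound

end

end Summit.QuantumFields.BalabanUV.T4Continuum.NE7PerturbedCompositesAdd
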